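import Summits.ValiantsHypothesis.ValiantsHypothesis.Theses.SymPencil
import Summits.ValiantsHypothesis.ValiantsHypothesis.Theorems.SymPencilSymmetrizePermPairsStubInduce

/-!
# Birth skeleton — crux `SymPencil.SymmetrizePermPairs` (item stmt-ValiantsHypothesis-17793)

Line STABILISER-INDEX + INDUCTION (crux-strategist cstrat-5673, 2026-08-17).  The crux: every
symmetric affine pencil of size `m` for `per_n` can be replaced by a `Γ_n`-EQUIVARIANT symmetric one
(`Γ_n ≅ 𝔖_n × 𝔖_n` row/column permutation pairs, exact linear lifts) of size `≤ 2^{(log₂ m + d)^d}`.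

Why a finite group needs its own mechanism: rigidity hands over CONNECTED symmetry for free (a torus
must fix an isolated gauge class — route RigidityForcesSymmetry's `RigidityForcesTorus`, proved), but
a finite group may PERMUTE isolated gauge classes; what it cannot do cheaply is move a class through
an orbit longer than the number of classes.  Hence the two stubs (sorries ONLY here):

* `stub_stabIndex` (XL, the rigidity content) — a MINIMAL symmetric pencil of `per_n` (size
  `m = sdc(per_n)`) is equivariant, with exact linear lifts, for a subgroup `Γ' ≤ Γ_n` of
  quasi-polynomial relative index `[Γ_n : Γ'] ≤ 2^{(log₂ m + d)^d}`: the stabiliser of its congruence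
  gauge class, whose index is the length of the `Γ_n`-orbit of the class, at most the NUMBER of gauge
  classes of minimal symmetric pencils (finiteness/rigidity of minimal representations up to
  congruence; Grenet-like one-sided pencils have orbits of length `n! ≤ qp(2^n)`, consistent).
* `stub_induce` (L, constructive) — equivariance for `Γ'` of relative index `R` induces `Γ_n`-
  equivariance at size `≤ 2^{(log₂ (mR + m) + d)^d}`: perm-ify the linear lifts of `Γ'` (as in the
  sibling skeleton of `EquivariantSdcNotQP`), sum the `R` coset translates in the weakly-skew / ABP
  model (per is `Γ_n`-invariant, so each translate computes `per_n`), and return to a symmetric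
  pencil by the FUNCTORIAL Grenet–Kaltofen–Koiran–Portier construction (Thm 4), on which `Γ_n` acts by
  graph automorphisms, i.e. by permutation-matrix congruences.

rev 2026-08-28 (tenure g11 per director-valiant R91): `stub_induce` RE-POINTED to the landed theorem
`…Theorems.SymPencilEquivariantSdcNotQP.stub_induce` (p605543); the ONLY remaining sorry is `stub_stabIndex`
(XL rigidity, LAW-class, 0 provers; natural target of one crux-strategist seat `cstrat-17793-stabIndex`).
The permify step (`stub_permify`, p6) lives inside the tree proof of `stub_induce` and was never a stub here.

Composition `symmetrizePermPairs_of` (kernel-checked, no sorry): pass to a minimal symmetric pencil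
(`Nat.find`), apply the two stubs, and compose the quasi-polynomial bounds (`aux_exp`, `qpExp_comp`).
-/

noncomputable section

-- single-conjunct layout: Sub = Summit, duplicated namespace component intended
set_option linter.dupNamespace false

namespace Summit.ValiantsHypothesis.ValiantsHypothesis.Cruxes.SymmetrizePermPairs.Birth

open Literature.Computability.AlgebraicComplexity MvPolynomial Matrix
open Summit.ValiantsHypothesis.ValiantsHypothesis.Theses

/-- `Γ_n`: the row/column permutation pairs as a subgroup of `GL(n², ℂ)` — the body used verbatim by
the route items. -/
abbrev permPairSubst (n : ℕ) : Subgroup (GL (Fin n × Fin n) ℂ) :=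
  Subgroup.closure {γ : GL (Fin n × Fin n) ℂ | ∃ π ρ : Equiv.Perm (Fin n),
    (γ : Matrix (Fin n × Fin n) (Fin n × Fin n) ℂ) = Equiv.Perm.permMatrix ℂ (Equiv.prodCongr π ρ)}

/-! ### Stubs -/

/-- **stub_stabIndex** (XL).  A minimal symmetric affine pencil of `per_n` is equivariant (exact
linear lifts) for a subgroup of `Γ_n` of quasi-polynomial relative index. -/
theorem stub_stabIndex :
    ∃ d : ℕ, ∀ (n m : ℕ) (A : Matrix (Fin m) (Fin m) (MvPolynomial (Fin n × Fin n) ℂ)),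
      A.IsSymm → IsAffineDetRepr (perPoly (Fin n) ℂ) A →
      (∀ (m' : ℕ) (A' : Matrix (Fin m') (Fin m') (MvPolynomial (Fin n × Fin n) ℂ)),
        A'.IsSymm → IsAffineDetRepr (perPoly (Fin n) ℂ) A' → m ≤ m') →
      ∃ Γ' : Subgroup (GL (Fin n × Fin n) ℂ), Γ' ≤ permPairSubst n ∧
        Γ'.relIndex (permPairSubst n) ≤ 2 ^ ((Nat.log 2 m + d) ^ d) ∧
        IsEquivariantDetRepr Γ' (perPoly (Fin n) ℂ) A := by
  sorry

/-- **stub_induce** (L) — NOW A THEOREM (p605543; kept under its stub name so the composition below is unchanged).  Equivariance for a subgroup `Γ' ≤ Γ_n` of relative index `R` induces full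
`Γ_n`-equivariance of a symmetric pencil at quasi-polynomial cost in `m R + m`. -/
theorem stub_induce :
    ∃ d : ℕ, ∀ (n m : ℕ) (A : Matrix (Fin m) (Fin m) (MvPolynomial (Fin n × Fin n) ℂ))
      (Γ' : Subgroup (GL (Fin n × Fin n) ℂ)), Γ' ≤ permPairSubst n →
      A.IsSymm → IsEquivariantDetRepr Γ' (perPoly (Fin n) ℂ) A →
      ∃ m' ≤ 2 ^ ((Nat.log 2 (m * Γ'.relIndex (permPairSubst n) + m) + d) ^ d),
        ∃ A' : Matrix (Fin m') (Fin m') (MvPolynomial (Fin n × Fin n) ℂ),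
          A'.IsSymm ∧ IsEquivariantDetRepr (permPairSubst n) (perPoly (Fin n) ℂ) A' :=
  -- rev (tenure g11, 2026-08-28, director-valiant R91): RE-POINTED TO THE TREE — `stub_induce` is a
  -- THEOREM: p605543 `Theorems/SymPencilSymmetrizePermPairsStubInduce.lean` (val-lit p6 g12), whose
  -- statement is this stub's with the `abbrev permPairSubst` unfolded.  No sorry here any more.
  Summit.ValiantsHypothesis.ValiantsHypothesis.Theorems.SymPencilEquivariantSdcNotQP.stub_induce

/-! ### Arithmetic (proved) -/

/-- qp ∘ qp exponent bookkeeping: `((L + c)^c + d)^d ≤ (L + e)^e`, `e = (c+1)(d+1)`. [folklore] -/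
theorem qpExp_comp (L c d : ℕ) :
    ((L + c) ^ c + d) ^ d ≤ (L + (c + 1) * (d + 1)) ^ ((c + 1) * (d + 1)) := by
  set a := L + c + d + 1 with ha
  have hac : (L + c) ^ c ≤ a ^ c := Nat.pow_le_pow_left (by omega) c
  have ha1 : 1 ≤ a ^ c := Nat.one_le_pow _ _ (by omega)
  have h1 : (L + c) ^ c + d ≤ a ^ (c + 1) := by
    calc (L + c) ^ c + d ≤ a ^ c + d * a ^ c := by nlinarith
      _ = (d + 1) * a ^ c := by ring
      _ ≤ a * a ^ c := Nat.mul_le_mul_right _ (by omega)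
      _ = a ^ (c + 1) := by ring
  have h2 : ((L + c) ^ c + d) ^ d ≤ (a ^ (c + 1)) ^ d := Nat.pow_le_pow_left h1 d
  have hcd : c + d + 1 ≤ (c + 1) * (d + 1) := by nlinarith
  have h4 : a ≤ L + (c + 1) * (d + 1) := by omega
  have h5 : a ^ ((c + 1) * d) ≤ (L + (c + 1) * (d + 1)) ^ ((c + 1) * d) :=
    Nat.pow_le_pow_left h4 _
  have h6 : (L + (c + 1) * (d + 1)) ^ ((c + 1) * d) ≤
      (L + (c + 1) * (d + 1)) ^ ((c + 1) * (d + 1)) :=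
    Nat.pow_le_pow_right (by nlinarith) (by nlinarith)
  calc ((L + c) ^ c + d) ^ d ≤ (a ^ (c + 1)) ^ d := h2
    _ = a ^ ((c + 1) * d) := by rw [← pow_mul]
    _ ≤ (L + (c + 1) * (d + 1)) ^ ((c + 1) * d) := h5
    _ ≤ (L + (c + 1) * (d + 1)) ^ ((c + 1) * (d + 1)) := h6

/-- `L + 2 + (L + a)^a ≤ (L + 2 + (a+1))^{a+1}`. [folklore] -/
theorem aux_exp (L a : ℕ) : L + 2 + (L + a) ^ a ≤ (L + 2 + (a + 1)) ^ (a + 1) := by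
  rcases a with _ | a
  · simp
  · set b := L + 2 + (a + 1 + 1) with hb
    have hb3 : L + 3 ≤ b := by omega
    have hk : (L + (a + 1)) ^ (a + 1) ≤ b ^ (a + 1) := Nat.pow_le_pow_left (by omega) _
    have hbb : b ≤ b ^ (a + 1) := by
      calc b = b ^ 1 := (pow_one b).symm
        _ ≤ b ^ (a + 1) := Nat.pow_le_pow_right (by omega) (by omega)
    calc L + 2 + (L + (a + 1)) ^ (a + 1) ≤ b ^ (a + 1) + b ^ (a + 1) := by omega
      _ = 2 * b ^ (a + 1) := by ring
      _ ≤ b * b ^ (a + 1) := Nat.mul_le_mul_right _ (by omega)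
      _ = b ^ (a + 1 + 1) := by ring

/-! ### Composition: the stubs conclude the crux BY NAME -/

/-- **`SymmetrizePermPairs` from the stubs**: pass to a minimal symmetric pencil (`Nat.find`), take its
quasi-polynomial-index symmetry subgroup (`stub_stabIndex`), induce (`stub_induce`), compose bounds. -/
theorem symmetrizePermPairs_of
    (h₁ : ∃ d : ℕ, ∀ (n m : ℕ) (A : Matrix (Fin m) (Fin m) (MvPolynomial (Fin n × Fin n) ℂ)),
      A.IsSymm → IsAffineDetRepr (perPoly (Fin n) ℂ) A →
      (∀ (m' : ℕ) (A' : Matrix (Fin m') (Fin m') (MvPolynomial (Fin n × Fin n) ℂ)),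
        A'.IsSymm → IsAffineDetRepr (perPoly (Fin n) ℂ) A' → m ≤ m') →
      ∃ Γ' : Subgroup (GL (Fin n × Fin n) ℂ), Γ' ≤ permPairSubst n ∧
        Γ'.relIndex (permPairSubst n) ≤ 2 ^ ((Nat.log 2 m + d) ^ d) ∧
        IsEquivariantDetRepr Γ' (perPoly (Fin n) ℂ) A)
    (h₂ : ∃ d : ℕ, ∀ (n m : ℕ) (A : Matrix (Fin m) (Fin m) (MvPolynomial (Fin n × Fin n) ℂ))
      (Γ' : Subgroup (GL (Fin n × Fin n) ℂ)), Γ' ≤ permPairSubst n →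
      A.IsSymm → IsEquivariantDetRepr Γ' (perPoly (Fin n) ℂ) A →
      ∃ m' ≤ 2 ^ ((Nat.log 2 (m * Γ'.relIndex (permPairSubst n) + m) + d) ^ d),
        ∃ A' : Matrix (Fin m') (Fin m') (MvPolynomial (Fin n × Fin n) ℂ),
          A'.IsSymm ∧ IsEquivariantDetRepr (permPairSubst n) (perPoly (Fin n) ℂ) A') :
    -- the BODY of `SymPencil.SymmetrizePermPairs` (so that only `SymmetrizePermPairs_of` below concludes
    -- the crux by name, as the skeleton audit requires; the two agree by `Iff.rfl`)
    ∃ d : ℕ, ∀ (n m : ℕ) (A : Matrix (Fin m) (Fin m) (MvPolynomial (Fin n × Fin n) ℂ)),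
      A.IsSymm → IsAffineDetRepr (perPoly (Fin n) ℂ) A →
      ∃ m' ≤ 2 ^ ((Nat.log 2 m + d) ^ d), ∃ A' : Matrix (Fin m') (Fin m') (MvPolynomial (Fin n × Fin n) ℂ),
        A'.IsSymm ∧ IsEquivariantDetRepr (permPairSubst n) (perPoly (Fin n) ℂ) A' := by
  obtain ⟨a, ha⟩ := h₁
  obtain ⟨b, hb⟩ := h₂
  refine ⟨(a + 2) * (b + 1) + 2, fun n m A hAs hA => ?_⟩
  classical
  -- a minimal symmetric affine pencil of per_n
  have hex : ∃ k, ∃ B : Matrix (Fin k) (Fin k) (MvPolynomial (Fin n × Fin n) ℂ),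
      B.IsSymm ∧ IsAffineDetRepr (perPoly (Fin n) ℂ) B := ⟨m, A, hAs, hA⟩
  obtain ⟨B, hBs, hB⟩ := Nat.find_spec hex
  have hmin : ∀ (m' : ℕ) (A' : Matrix (Fin m') (Fin m') (MvPolynomial (Fin n × Fin n) ℂ)),
      A'.IsSymm → IsAffineDetRepr (perPoly (Fin n) ℂ) A' → Nat.find hex ≤ m' :=
    fun m' A' h1 h2 => Nat.find_min' hex ⟨A', h1, h2⟩
  have hm₀m : Nat.find hex ≤ m := hmin m A hAs hA
  obtain ⟨Γ', hle, hidx, hBeq⟩ := ha n (Nat.find hex) B hBs hB hmin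
  obtain ⟨m', hm', A', hA's, hA'⟩ := hb n (Nat.find hex) B Γ' hle hBs hBeq
  refine ⟨m', hm'.trans ?_, A', hA's, hA'⟩
  -- bounds (m₀ := Nat.find hex, R := [Γ_n : Γ'], L := log₂ m)
  set L := Nat.log 2 m with hL
  have hQ : Γ'.relIndex (permPairSubst n) ≤ 2 ^ ((L + a) ^ a) := by
    refine hidx.trans (Nat.pow_le_pow_right (by norm_num) ?_)
    exact Nat.pow_le_pow_left (by have := Nat.log_mono_right (b := 2) hm₀m; omega) a
  have hm2 : m < 2 ^ (L + 1) := Nat.lt_pow_succ_log_self one_lt_two m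
  have hQ1 : 1 ≤ 2 ^ ((L + a) ^ a) := Nat.one_le_two_pow
  have hprod : Nat.find hex * Γ'.relIndex (permPairSubst n) + Nat.find hex ≤
      2 ^ (L + 2 + (L + a) ^ a) := by
    have h1 : Nat.find hex * Γ'.relIndex (permPairSubst n) + Nat.find hex ≤
        m * 2 ^ ((L + a) ^ a) + m := by
      have := Nat.mul_le_mul hm₀m hQ
      omega
    have h3 : m * 2 ^ ((L + a) ^ a) ≤ 2 ^ (L + 1) * 2 ^ ((L + a) ^ a) :=
      Nat.mul_le_mul_right _ hm2.le
    have h4 : m ≤ 2 ^ (L + 1) * 2 ^ ((L + a) ^ a) := by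
      calc m ≤ 2 ^ (L + 1) := hm2.le
        _ = 2 ^ (L + 1) * 1 := (mul_one _).symm
        _ ≤ 2 ^ (L + 1) * 2 ^ ((L + a) ^ a) := Nat.mul_le_mul_left _ hQ1
    have h5 : 2 ^ (L + 1) * 2 ^ ((L + a) ^ a) + 2 ^ (L + 1) * 2 ^ ((L + a) ^ a) =
        2 ^ (L + 2 + (L + a) ^ a) := by
      ring
    calc Nat.find hex * Γ'.relIndex (permPairSubst n) + Nat.find hex ≤ m * 2 ^ ((L + a) ^ a) + m := h1
      _ ≤ 2 ^ (L + 1) * 2 ^ ((L + a) ^ a) + 2 ^ (L + 1) * 2 ^ ((L + a) ^ a) := by omega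
      _ = 2 ^ (L + 2 + (L + a) ^ a) := h5
  have hlog : Nat.log 2 (Nat.find hex * Γ'.relIndex (permPairSubst n) + Nat.find hex) ≤
      L + 2 + (L + a) ^ a := by
    calc Nat.log 2 (Nat.find hex * Γ'.relIndex (permPairSubst n) + Nat.find hex)
        ≤ Nat.log 2 (2 ^ (L + 2 + (L + a) ^ a)) := Nat.log_mono_right hprod
      _ = L + 2 + (L + a) ^ a := Nat.log_pow one_lt_two _
  have hlog' : Nat.log 2 (Nat.find hex * Γ'.relIndex (permPairSubst n) + Nat.find hex) ≤
      (L + 2 + (a + 1)) ^ (a + 1) := hlog.trans (aux_exp L a)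
  apply Nat.pow_le_pow_right (by norm_num)
  calc (Nat.log 2 (Nat.find hex * Γ'.relIndex (permPairSubst n) + Nat.find hex) + b) ^ b
      ≤ ((L + 2 + (a + 1)) ^ (a + 1) + b) ^ b := Nat.pow_le_pow_left (by omega) b
    _ ≤ (L + 2 + (a + 2) * (b + 1)) ^ ((a + 2) * (b + 1)) := qpExp_comp (L + 2) (a + 1) b
    _ ≤ (L + ((a + 2) * (b + 1) + 2)) ^ ((a + 2) * (b + 1)) := Nat.pow_le_pow_left (by omega) _
    _ ≤ (L + ((a + 2) * (b + 1) + 2)) ^ ((a + 2) * (b + 1) + 2) :=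
        Nat.pow_le_pow_right (by omega) (by omega)

/-- **Registered composition** (`<CruxDecl>_of` shape for `ledger skeleton check`): the crux BY NAME
from the two declared stubs used directly (the only `sorry`s in its cone are theirs).
`symmetrizePermPairs_of` above is the sorry-free certificate of the same composition with the stub
statements as explicit hypotheses. -/
theorem SymmetrizePermPairs_of : SymPencil.SymmetrizePermPairs :=
  symmetrizePermPairs_of stub_stabIndex stub_induce

/-- The certificate's conclusion is the crux verbatim. -/
example : SymPencil.SymmetrizePermPairs ↔
    ∃ d : ℕ, ∀ (n m : ℕ) (A : Matrix (Fin m) (Fin m) (MvPolynomial (Fin n × Fin n) ℂ)),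
      A.IsSymm → IsAffineDetRepr (perPoly (Fin n) ℂ) A →
      ∃ m' ≤ 2 ^ ((Nat.log 2 m + d) ^ d), ∃ A' : Matrix (Fin m') (Fin m') (MvPolynomial (Fin n × Fin n) ℂ),
        A'.IsSymm ∧ IsEquivariantDetRepr (permPairSubst n) (perPoly (Fin n) ℂ) A' := Iff.rfl

end Summit.ValiantsHypothesis.ValiantsHypothesis.Cruxes.SymmetrizePermPairs.Birth
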